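import Summits.QuantumFields.YangMills.Theorems.BalabanUVNodesN19LedgerPieces
import Literature.MathematicalPhysics.QuantumFieldTheory.Balaban1983to89.T4VarianceMatching

/-!
# BalabanUVNodes ∕ N19 (NE7 proper) — ROAD (i) IS CLOSED UNDER A COMMON DRESSING OF ITS REFERENCE MEASURE: the synchronised two-run ledger predicate `LedgerAtSync`
# (37 fields, `…N19LedgerLinkSync` p413834 ∕ the (F)-split `…N19LedgerPieces` p475201) transfers along the tilt `μ ↦ μ.withDensity e^{t·W}` of its ONE measure field, so the landed
# edge `core_summable_of_ledgerAtSync` gives the DRESSED `Spine.NE7.Core` for every bounded unit-scale observable with the SAME `δ` — no (I)-binder, no `MGFForm`, no `l₀`-smallness,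
# no `0 < vol` — lens decomp v8 ROW LEDGER-DRESS

Cell `pub-ymgap` (HUMAN RULING D-0062, Track A), R134 ACCELERATION seat `pub-ymgap-dag-n19-d` (strategy s2), gen 7, module 28.  Lens decomp g8 [LENS-DECOMP-V8-EARLY] (INBOX l.16994,
06:01Z): «ROW LEDGER-DRESS → dag-n19-d g7 (first claim): lift sketch v8 §0–§3 + §5 (§4 optional) into `Summits/QuantumFields/YangMills/Theorems/BalabanUVNodesN19LedgerDress.lean`
(imports `…N19LedgerPieces`); THEOREMS + at most the one data-map `def` … if kept, RENAME `dress` …; ZERO ESTIMATE CONTENT; it SUPERSEDES ROW DENS-VAC (1) and (3) and ROW LEDGER-TRIM»;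
sketch `ym-lens-BalabanUVNodes-decomp/lean/LensDecompNE7v8.sketch.lean` sha16 b3c3003b9c131a7d, farm rc 0 · 0 warnings · 0 sorry — §0–§5 LIFTED HERE decl by decl (CREDITED); the ONE
data-map `def` kept under the name `tilt` (its four `rfl`∕`simp` faces `tilt_μ ∕ tilt_fac ∕ tilt_oA ∕ tilt_oB ∕ tilt_μ_zero`); every theorem keeps the sketch's name; §4's re-proved
`integral_withDensity_ofReal_mul'` is NOT re-declared (t4's `T4VarianceMatching.integral_withDensity_ofReal_mul` CITED).  Filed `--kind definition` (one `def`) `--supports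
stmt-QuantumFields-20292 --as helper` (K3⁗ `SpineGivenEndpointR13Sep`; dag-lead WORDS-140).  COUNT-NEUTRAL.  No Theses import; edits nothing.

THE POINT (lens v8).  In `LedgerAtSync L l₀ vol T Bad A B …` the common fluctuation measure `L.μ K t τ` occurs in EXACTLY three fields (`fmtA fmtB int`, all in F1 `TwoRunFormat`), and every
estimate-carrying field (`size`, `other`, `u5b`, `cf_le`, …) is POINTWISE in the integration variable `v`.  Hence replacing `L.μ K t τ` by its tilt `(L.μ K t τ).withDensity (e^{t·W})` (ONE data
field changed: `tilt L W`) carries `LedgerAtSync L … A B …` to `LedgerAtSync (tilt L W) … P Q …` for the DRESSED cores `P K t τ = ∫ (run-A integrand)·e^{t W} dμ` (§2), and road (i)'s LANDED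
edge `core_summable_of_ledgerAtSync` then yields `∃ δ, NE7.Core l₀ vol T Bad P Q δ ∧ Summable δ` with the SAME `δ` (§3).  Read at the VACUUM instance (every `t`-slot of the data `t`-constant):
the dressed N19 edge for the observables of record needs NO `TiltedMeanMatching` (N14's binder), NO `MGFForm`, NO `0 < vol`, NO smallness of `l₀` — compare module 14
`N19VacuumMGFRoad.coreEdge_of_vacuumLedgerAtSync_mgfForm` (road (ii): four extra binders, remainder `δ⁰ + (l₀∕vol)·η`).
* §0 `exp_mul_le_exp_of_abs_le` · `integral_dress` · `integrable_dress` (Mathlib-only helpers).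
* §1 `tilt` (the data map) · `tilt_μ` · `tilt_fac` · `tilt_oA` · `tilt_oB` · `tilt_μ_zero`.
* §2 the six pieces transfer: `twoRunFormat_dress` (F1 — the ONLY piece that sees `μ`) · `booking_dress` · `otherKinds_dress` · `finestStep_dress` (F3′ = the frame's ONE estimate NEVER sees `μ`) ·
  `size_dress` · `conventions_dress`; ★ `ledgerAtSync_dress` (reassembly by `ledgerAtSync_of_pieces`).
* §3 `core_congr_on_good` · ★ `core_summable_dress` (road (i)'s edge `core_summable_of_ledgerAtSync` VERBATIM at the tilted data: in-edges BY NAME — NE3Shape ∕ GaugeDominated ∕ NE5 ∕ NE9+FadingMemory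
  ∕ InjectedRate ∕ box ∕ LipBackground ∕ PolyLipGrowth ∕ W-membership) · `coreEdge_of_ledgerAtSync_dressedOnGood` (format asked on the GOOD classes only) · ★ `coreEdge_dress_of_vacuumLedgerAtSync`
  (the VACUUM ledger + ONE measurable bounded `Wt` + the dressed format ⇒ `∃ δ, Core … P Q δ ∧ Summable δ`).
* §4 `mgf_eq_dressedIntegral_of_rep` · `dressedFormat_of_rep` — the single-run junction: an MGF `∫ e^{t·φ(a ω)} dν` + a REPRESENTATION identity `ν.map a = (μ.withDensity (ofReal ∘ f)).map fld`
  (class measure pushed by the run's KEY MAP `a` = `A_K` of `UnitFactorisation.fac`, module 26 p500938 §1, = ledger density pushed by the readings' field map — the object-bound identity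
  «RG images are densities», [Balaban1987RG1] (0.13) p.254 ∕ [Balaban1988Convergent] (2.24)–(2.25), cell NODE O) ⇒ the dressed format; pure transport.
* §5 `s_N19_of_dressedLedgerReading` — the `S_N19` reading at the spine carriers on this road (binder list = `N19AtSpineCarriers.s_N19_of_ledgerAtSyncReading`'s with the ledger asked for
  SOME cores `A₀ B₀` + `Measurable Wt ∧ |Wt| ≤ Bw ∧` the dressed format of the shell-free cores on good classes).
SCOPE (lens v8, binding): exact for D1 observables (`UnitFactorisation`: `obs K o = W o ∘ A_K`) at the SELECTORS OF RECORD; the junction §4's representation identity is NODE O's object-bound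
statement, not produced here.

HONEST FRAMING.  ZERO ESTIMATE CONTENT: kernel bookkeeping over hypothesis SHAPES of the tree, cited BY NAME (`withDensity` arithmetic); every ledger field, in-edge letter, format and
representation identity is a HYPOTHESIS (0∕1); nothing of Bałaban's is instantiated; NE7 NOT PROVED; N19 NOT discharged; K3⁗ NOT claimed; counts UNMOVED (typed 28∕28 · discharged 5∕27,
A 5∕28); one finite four-torus programme at fixed `ε` — NOT ℝ⁴ ∕ infinite volume ∕ OS ∕ mass gap ∕ Clay.  ONE `def` (`tilt`, a data-bundle map; no instance, no notation), 0 `sorry`; standard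
axioms; no decl below carries a cite tag.
-/

set_option autoImplicit false

noncomputable section

open Finset MeasureTheory
open scoped BigOperators ENNReal

namespace Summit.QuantumFields.YangMills.BalabanUVNodes.N19LedgerDress

open Literature.MathematicalPhysics.QuantumFieldTheory.Balaban1983to89
open T4OutputRate T4RecentScale T4GoodClassBudget T4CauchySum T4TowerRateComposition T4TowerRateDischarge
open T4EtaRateMin (Readings NE3Shape)
open T4RateLiaison (GaugeDominated)
open Summit.QuantumFields.BalabanUV.T4Continuum.Spine
open Summit.QuantumFields.YangMills.BalabanUVNodes.N19AtSpineCarriers (deltaOfRecord s_N19_of_coreEdge)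
open Summit.QuantumFields.YangMills.BalabanUVNodes.N19LedgerLinkSync (LedgerDataSync LedgerAtSync core_summable_of_ledgerAtSync)
open Summit.QuantumFields.YangMills.BalabanUVNodes.N19LedgerPieces
open YMDAG.UVSplit (SpineCarriers SpineRecordPred InputsPred S_N19)

/-! ## §0 Two measure-theory helpers (Mathlib only) -/

section Helpers

variable {α : Type*} [MeasurableSpace α]

/-- `|t| ≤ l₀`, `|w| ≤ B` ⇒ `e^{t w} ≤ e^{l₀ B}`. Lens v8 sketch, lifted. [folklore] -/
theorem exp_mul_le_exp_of_abs_le {t l₀ w B : ℝ} (ht : |t| ≤ l₀) (hw : |w| ≤ B) :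
    Real.exp (t * w) ≤ Real.exp (l₀ * B) := by
  apply Real.exp_le_exp.mpr
  calc t * w ≤ |t * w| := le_abs_self _
    _ = |t| * |w| := abs_mul t w
    _ ≤ l₀ * B := mul_le_mul ht hw (abs_nonneg w) ((abs_nonneg t).trans ht)

/-- Integration against the tilted measure `μ.withDensity e^{t W}` is integration of `φ · e^{t W}` against `μ` (no integrability
hypothesis: both sides are Bochner integrals with the same junk convention). Lens v8 sketch, lifted. [folklore] -/
theorem integral_dress (μ : Measure α) {W : α → ℝ} (hWm : Measurable W) (t : ℝ) (φ : α → ℝ) :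
    ∫ v, φ v ∂(μ.withDensity fun v => ENNReal.ofReal (Real.exp (t * W v))) = ∫ v, φ v * Real.exp (t * W v) ∂μ := by
  have hgm : Measurable fun v => Real.exp (t * W v) := (measurable_const.mul hWm).exp
  have h : (fun v => ENNReal.ofReal (Real.exp (t * W v))) =
      fun v => ((fun v => (Real.exp (t * W v)).toNNReal) v : ℝ≥0∞) := rfl
  rw [h, integral_withDensity_eq_integral_smul hgm.real_toNNReal φ]
  refine integral_congr_ae (ae_of_all _ fun v => ?_)
  show (Real.exp (t * W v)).toNNReal • φ v = φ v * Real.exp (t * W v)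
  rw [NNReal.smul_def, smul_eq_mul, Real.coe_toNNReal _ (Real.exp_pos _).le, mul_comm]

/-- Integrability survives the tilt by a bounded exponential weight. Lens v8 sketch, lifted. [folklore] -/
theorem integrable_dress {μ : Measure α} {f : α → ℝ} (hf : Integrable f μ) {W : α → ℝ} {B t l₀ : ℝ}
    (hWb : ∀ v, |W v| ≤ B) (ht : |t| ≤ l₀) :
    Integrable f (μ.withDensity fun v => ENNReal.ofReal (Real.exp (t * W v))) := by
  have hle : (μ.withDensity fun v => ENNReal.ofReal (Real.exp (t * W v))) ≤
      μ.withDensity fun _ => ENNReal.ofReal (Real.exp (l₀ * B)) :=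
    withDensity_mono (ae_of_all _ fun v => ENNReal.ofReal_le_ofReal (exp_mul_le_exp_of_abs_le ht (hWb v)))
  rw [withDensity_const] at hle
  exact (hf.smul_measure ENNReal.ofReal_ne_top).mono_measure hle

end Helpers

/-! ## §1 The dressing of the ledger DATA: one field changes -/

section Dress

variable {C : Carriers} {F : Type*} {ι : Type} [MeasurableSpace ι] {σ : Type*}

/-- **DRESSING OF THE SYNCHRONISED LEDGER DATA** by a unit-scale observable `W : ι → ℝ` of the integration variable: the common fluctuation
measure at source `t` is tilted by `e^{t·W}`; EVERY other field (E-ledger, reference ledger, other kinds, node-U5b ledger, remaining kinds, sizes,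
letters) is unchanged. Lens v8 sketch's `dress`, lifted under the name `tilt` (lens ROW LEDGER-DRESS: «if kept, RENAME `dress`»). [folklore] (a map of data bundles; no estimate) -/
def tilt (L : LedgerDataSync C F ι σ) (W : ι → ℝ) : LedgerDataSync C F ι σ :=
  { L with μ := fun K t τ => (L.μ K t τ).withDensity fun v => ENNReal.ofReal (Real.exp (t * W v)) }

/-- The tilted measure field (`rfl`). Lens v8 sketch, lifted. [folklore] -/
theorem tilt_μ (L : LedgerDataSync C F ι σ) (W : ι → ℝ) (K : ℕ) (t : ℝ) (τ : σ) :
    (tilt L W).μ K t τ = (L.μ K t τ).withDensity fun v => ENNReal.ofReal (Real.exp (t * W v)) := rfl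

/-- `tilt` leaves the factor ledger unchanged (`rfl`). Lens v8 sketch, lifted. [folklore] -/
theorem tilt_fac (L : LedgerDataSync C F ι σ) (W : ι → ℝ) : (tilt L W).fac = L.fac := rfl
/-- `tilt` leaves run A's other-kinds factor unchanged (`rfl`). Lens v8 sketch, lifted. [folklore] -/
theorem tilt_oA (L : LedgerDataSync C F ι σ) (W : ι → ℝ) : (tilt L W).oA = L.oA := rfl
/-- `tilt` leaves run B's other-kinds factor unchanged (`rfl`). Lens v8 sketch, lifted. [folklore] -/
theorem tilt_oB (L : LedgerDataSync C F ι σ) (W : ι → ℝ) : (tilt L W).oB = L.oB := rfl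

/-- At source `t = 0` the dressing is the identity on the measure. Lens v8 sketch, lifted. [folklore] -/
theorem tilt_μ_zero (L : LedgerDataSync C F ι σ) (W : ι → ℝ) (K : ℕ) (τ : σ) :
    (tilt L W).μ K 0 τ = L.μ K 0 τ := by
  simp [tilt]

end Dress

/-! ## §2 The six pieces and the whole predicate transfer along the dressing -/

section Transfer

variable {C : Carriers} [DecidableEq C.Dom] {F : Type*} {ι X : Type} [MeasurableSpace ι] {σ : Type*} [DecidableEq σ]
  {L : LedgerDataSync C F ι σ} {l₀ vol : ℝ} {T : ℕ → Finset σ} {Bad : ℕ → ℝ → Finset σ} {A B P Q : ℕ → ℝ → σ → ℝ}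
  {R : Readings ι X} {EA : Functional C C.BgA} {EB : Functional C C.BgB} {κ : ℝ} {g : ℕ → ℕ → ℝ}
  {uA : ℕ → ι → C.BgA} {uB : ℕ → ι → C.BgB} {ω θc θ₅ θ₃ : ℝ} {W : ι → ℝ} {Bw : ℝ}

omit [DecidableEq C.Dom] in
/-- **F1 TRANSFERS**: the two-run FORMAT of the undressed cores `A B` against `L.μ` gives the two-run format of the DRESSED cores
`P K t τ = ∫ (run-A integrand)·e^{tW} dL.μ`, `Q` likewise, against the tilted measure — same integrands, same E-ledger, integrable for
`|t| ≤ l₀` (bounded weight), vanishing off `R.dom` (same integrands). Lens v8 sketch, lifted. [folklore] -/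
theorem twoRunFormat_dress (hF : TwoRunFormat L l₀ T Bad A B R EA EB g uA uB) (hWm : Measurable W) (hWb : ∀ v, |W v| ≤ Bw)
    (hP : ∀ K t τ, P K t τ = ∫ v, (∏ X ∈ L.fac K t τ,
      Real.exp (EA (g K) (uA K v) X - EA (g K) L.oneA X)) * L.oA K t τ v * Real.exp (t * W v) ∂(L.μ K t τ))
    (hQ : ∀ K t τ, Q K t τ = ∫ v, (∏ X ∈ L.fac K t τ,
      Real.exp (EB (fun i => g (K + 1) (i + 1)) (uB K v) X - EB (fun i => g (K + 1) (i + 1)) L.oneB X)) *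
        L.oB K t τ v * Real.exp (t * W v) ∂(L.μ K t τ)) :
    TwoRunFormat (tilt L W) l₀ T Bad P Q R EA EB g uA uB where
  fmtA K t τ := by
    show P K t τ = ∫ v, (∏ X ∈ L.fac K t τ, Real.exp (EA (g K) (uA K v) X - EA (g K) L.oneA X)) * L.oA K t τ v
      ∂((L.μ K t τ).withDensity fun v => ENNReal.ofReal (Real.exp (t * W v)))
    rw [integral_dress _ hWm]
    exact hP K t τ
  fmtB K t τ := by
    show Q K t τ = ∫ v, (∏ X ∈ L.fac K t τ,
      Real.exp (EB (fun i => g (K + 1) (i + 1)) (uB K v) X - EB (fun i => g (K + 1) (i + 1)) L.oneB X)) * L.oB K t τ v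
      ∂((L.μ K t τ).withDensity fun v => ENNReal.ofReal (Real.exp (t * W v)))
    rw [integral_dress _ hWm]
    exact hQ K t τ
  int K t ht τ hτ := by
    refine ⟨?_, ?_⟩
    · exact integrable_dress (hF.int K t ht τ hτ).1 hWb ht
    · exact integrable_dress (hF.int K t ht τ hτ).2 hWb ht
  off := hF.off

/-- F2 transfers verbatim (does not see `μ`). Lens v8 sketch, lifted. [folklore] -/
theorem booking_dress (h : LedgerBooking L l₀ vol T Bad κ) (W : ι → ℝ) : LedgerBooking (tilt L W) l₀ vol T Bad κ :=
  ⟨h.all_sub, h.all_sc, h.all_mult, h.Cl_nonneg, h.recent⟩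

omit [DecidableEq C.Dom] in
/-- F3 transfers verbatim. Lens v8 sketch, lifted. [folklore] -/
theorem otherKinds_dress (h : LedgerOtherKinds L l₀ vol T Bad R EA EB g) (W : ι → ℝ) :
    LedgerOtherKinds (tilt L W) l₀ vol T Bad R EA EB g :=
  ⟨h.ofmtA, h.ofmtB, h.u5b, h.CO_nonneg, h.wO_nonneg, h.orec, h.omult, h.cf_le, h.Cs_nonneg, h.posO⟩

omit [DecidableEq C.Dom] in
/-- **F3′ — THE FRAME's ONE ESTIMATE — transfers verbatim**: the finest-step two-run log-ratio of the remaining kinds is pointwise in `v`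
and never sees the reference measure, so a common dressing costs NOTHING in `rO″`, `s`. Lens v8 sketch, lifted. [folklore] -/
theorem finestStep_dress (h : FinestStepModConst L l₀ vol T Bad R) (W : ι → ℝ) : FinestStepModConst (tilt L W) l₀ vol T Bad R :=
  ⟨h.other, h.RO_le, h.rO_summable, h.cO_dev⟩

omit [DecidableEq C.Dom] in
/-- S transfers verbatim (the (2.43)-window size is pointwise in `v`). Lens v8 sketch, lifted. [folklore] -/
theorem size_dress (h : LedgerSize L l₀ vol T Bad R EA EB g uA uB) (W : ι → ℝ) :
    LedgerSize (tilt L W) l₀ vol T Bad R EA EB g uA uB :=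
  ⟨h.size, h.sizeProfile, h.E₀_nonneg, h.a_pos, h.a_lt_one⟩

omit [DecidableEq C.Dom] [DecidableEq σ] in
/-- C transfers verbatim. Lens v8 sketch, lifted. [folklore] -/
theorem conventions_dress (h : LedgerConventions L vol R ω θc θ₅ θ₃) (W : ι → ℝ) :
    LedgerConventions (tilt L W) vol R ω θc θ₅ θ₃ :=
  ⟨h.one, h.rvol, h.vol_nonneg, h.rate_gt, h.θ₅_le, h.θ₃_le, h.rate_lt_one, h.rate_le_base, h.one_le_base⟩

/-- **THE SYNCHRONISED LEDGER PREDICATE IS CLOSED UNDER A COMMON DRESSING** (reassembly of the six transfers by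
`N19LedgerPieces.ledgerAtSync_of_pieces`). Lens v8 sketch, lifted. [folklore] -/
theorem ledgerAtSync_dress (hL : LedgerAtSync L l₀ vol T Bad A B R EA EB κ g uA uB ω θc θ₅ θ₃)
    (hWm : Measurable W) (hWb : ∀ v, |W v| ≤ Bw)
    (hP : ∀ K t τ, P K t τ = ∫ v, (∏ X ∈ L.fac K t τ,
      Real.exp (EA (g K) (uA K v) X - EA (g K) L.oneA X)) * L.oA K t τ v * Real.exp (t * W v) ∂(L.μ K t τ))
    (hQ : ∀ K t τ, Q K t τ = ∫ v, (∏ X ∈ L.fac K t τ,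
      Real.exp (EB (fun i => g (K + 1) (i + 1)) (uB K v) X - EB (fun i => g (K + 1) (i + 1)) L.oneB X)) *
        L.oB K t τ v * Real.exp (t * W v) ∂(L.μ K t τ)) :
    LedgerAtSync (tilt L W) l₀ vol T Bad P Q R EA EB κ g uA uB ω θc θ₅ θ₃ :=
  ledgerAtSync_of_pieces (twoRunFormat_dress hL.twoRunFormat hWm hWb hP hQ) (booking_dress hL.booking W)
    (otherKinds_dress hL.otherKinds W) (finestStep_dress hL.finestStep W) (size_dress hL.size' W)
    (conventions_dress hL.conventions W)

end Transfer

/-! ## §3 The N19 edge for DRESSED cores from ANY synchronised ledger — same `δ`; the vacuum reading -/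

section Edge

variable {C : Carriers} [DecidableEq C.Dom] {F : Type*} {ι X : Type} [MeasurableSpace ι] {σ : Type*} [DecidableEq σ]
  {L : LedgerDataSync C F ι σ} {l₀ vol : ℝ} {T : ℕ → Finset σ} {Bad : ℕ → ℝ → Finset σ} {A B P Q : ℕ → ℝ → σ → ℝ}
  {R : Readings ι X} {W : Set (ℕ → ℝ)} {EA : Functional C C.BgA} {EB : Functional C C.BgB}
  {κ θ₅ C₅ C₉ ω θc Cd γ C₃ θ₃ Pg : ℝ} {q : ℕ} {Λm : ℕ → ℕ → ℝ} {CU : (ℕ → ℝ) → ℕ → ℝ}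
  {g : ℕ → ℕ → ℝ} {uA : ℕ → ι → C.BgA} {uB : ℕ → ι → C.BgB} {Wt : ι → ℝ} {Bw : ℝ}

/-- **`Core` only reads the good classes**: cores agreeing on every good class share every `Core` statement. Lens v8 sketch, lifted. [folklore] -/
theorem core_congr_on_good {l₀ vol : ℝ} {T : ℕ → Finset σ} {Bad : ℕ → ℝ → Finset σ} {P Q P' Q' : ℕ → ℝ → σ → ℝ} {δ : ℕ → ℝ}
    (h : ∀ K t, |t| ≤ l₀ → ∀ τ ∈ T K \ Bad K t, P' K t τ = P K t τ ∧ Q' K t τ = Q K t τ)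
    (hc : NE7.Core l₀ vol T Bad P Q δ) : NE7.Core l₀ vol T Bad P' Q' δ := by
  intro K
  obtain ⟨c, hcK⟩ := hc K
  refine ⟨c, fun t ht τ hτ => ?_⟩
  obtain ⟨h1, h2⟩ := h K t ht τ hτ
  rw [h1, h2]
  exact hcK t ht τ hτ

/-- **THE DRESSED N19 EDGE FROM ANY SYNCHRONISED LEDGER** (node U2's OUTPUT letter, in-edges BY NAME exactly as
`N19LedgerLinkSync.core_summable_of_ledgerAtSync`): a ledger `LedgerAtSync L … A B …` (ANY cores `A B` having its format — at the vacuum instance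
`A K t τ = P K 0 τ`), a measurable observable `Wt` of the integration variable bounded by `Bw`, and the DRESSED FORMAT of the cores `P Q`
(`P K t τ = ∫ (run-A integrand of the ledger)·e^{t·Wt} dL.μ`, `Q` likewise, ALL `K t τ`) ⇒ `∃ δ, NE7.Core l₀ vol T Bad P Q δ ∧ Summable δ` —
the SAME `δ` the ledger gives its own cores.  No `MGFForm`, no `TiltedMeanMatching`, no `0 < vol`, any `l₀`.  CONDITIONAL on every binder;
NOT NE7. Lens v8 sketch, lifted. [folklore] -/
theorem core_summable_dress (hL : LedgerAtSync L l₀ vol T Bad A B R EA EB κ g uA uB ω θc θ₅ θ₃)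
    (h16 : NE3Shape R C₃ θ₃) (hC₃ : 0 ≤ C₃) (hgd : GaugeDominated R uA uB)
    (h18 : NE5 EA EB W κ θ₅ C₅) (hθ₅ : 0 ≤ θ₅) (hC₅ : 0 ≤ C₅)
    (h22 : NE9 EA W κ Λm ∧ T4OutputRate.FadingMemory C₉ ω Λm) (hω : 0 ≤ ω)
    (hinj : InjectedRate Cd 0 θc (fun K j => T4CouplingMatching.disc (g K) (g (K + 1)) j)) (hCd : 0 ≤ Cd)
    (hθc : 0 ≤ θc) (hbox : ∀ K i, i ≤ K → 0 < g K i ∧ g K i ≤ γ)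
    (hU : LipBackground EA W κ CU) (hG : PolyLipGrowth CU g Pg q) (hPg : 0 ≤ Pg)
    (hgA : ∀ K, g K ∈ W) (hgB : ∀ K, (fun i => g (K + 1) (i + 1)) ∈ W)
    (hWm : Measurable Wt) (hWb : ∀ v, |Wt v| ≤ Bw)
    (hP : ∀ K t τ, P K t τ = ∫ v, (∏ X ∈ L.fac K t τ,
      Real.exp (EA (g K) (uA K v) X - EA (g K) L.oneA X)) * L.oA K t τ v * Real.exp (t * Wt v) ∂(L.μ K t τ))
    (hQ : ∀ K t τ, Q K t τ = ∫ v, (∏ X ∈ L.fac K t τ,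
      Real.exp (EB (fun i => g (K + 1) (i + 1)) (uB K v) X - EB (fun i => g (K + 1) (i + 1)) L.oneB X)) *
        L.oB K t τ v * Real.exp (t * Wt v) ∂(L.μ K t τ)) :
    ∃ δ : ℕ → ℝ, NE7.Core l₀ vol T Bad P Q δ ∧ Summable δ :=
  core_summable_of_ledgerAtSync (ledgerAtSync_dress hL hWm hWb hP hQ) h16 hC₃ hgd h18 hθ₅ hC₅ h22 hω hinj hCd hθc hbox
    hU hG hPg hgA hgB

/-- **THE SAME, WITH THE DRESSED FORMAT ASKED ON THE GOOD CLASSES ONLY** (what a representation identity of the record's class measures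
delivers, §4): the dressed integrals are `Core`-matched by `core_summable_dress`, and `Core` only reads the good classes. Lens v8 sketch, lifted. [folklore] -/
theorem coreEdge_of_ledgerAtSync_dressedOnGood (hL : LedgerAtSync L l₀ vol T Bad A B R EA EB κ g uA uB ω θc θ₅ θ₃)
    (h16 : NE3Shape R C₃ θ₃) (hC₃ : 0 ≤ C₃) (hgd : GaugeDominated R uA uB)
    (h18 : NE5 EA EB W κ θ₅ C₅) (hθ₅ : 0 ≤ θ₅) (hC₅ : 0 ≤ C₅)
    (h22 : NE9 EA W κ Λm ∧ T4OutputRate.FadingMemory C₉ ω Λm) (hω : 0 ≤ ω)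
    (hinj : InjectedRate Cd 0 θc (fun K j => T4CouplingMatching.disc (g K) (g (K + 1)) j)) (hCd : 0 ≤ Cd)
    (hθc : 0 ≤ θc) (hbox : ∀ K i, i ≤ K → 0 < g K i ∧ g K i ≤ γ)
    (hU : LipBackground EA W κ CU) (hG : PolyLipGrowth CU g Pg q) (hPg : 0 ≤ Pg)
    (hgA : ∀ K, g K ∈ W) (hgB : ∀ K, (fun i => g (K + 1) (i + 1)) ∈ W)
    (hWm : Measurable Wt) (hWb : ∀ v, |Wt v| ≤ Bw)
    (hP : ∀ K t, |t| ≤ l₀ → ∀ τ ∈ T K \ Bad K t, P K t τ = ∫ v, (∏ X ∈ L.fac K t τ,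
      Real.exp (EA (g K) (uA K v) X - EA (g K) L.oneA X)) * L.oA K t τ v * Real.exp (t * Wt v) ∂(L.μ K t τ))
    (hQ : ∀ K t, |t| ≤ l₀ → ∀ τ ∈ T K \ Bad K t, Q K t τ = ∫ v, (∏ X ∈ L.fac K t τ,
      Real.exp (EB (fun i => g (K + 1) (i + 1)) (uB K v) X - EB (fun i => g (K + 1) (i + 1)) L.oneB X)) *
        L.oB K t τ v * Real.exp (t * Wt v) ∂(L.μ K t τ)) :
    ∃ δ : ℕ → ℝ, NE7.Core l₀ vol T Bad P Q δ ∧ Summable δ := by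
  obtain ⟨δ, hc, hs⟩ := core_summable_dress hL h16 hC₃ hgd h18 hθ₅ hC₅ h22 hω hinj hCd hθc hbox hU hG hPg hgA hgB hWm hWb
    (P := fun K t τ => ∫ v, (∏ X ∈ L.fac K t τ,
      Real.exp (EA (g K) (uA K v) X - EA (g K) L.oneA X)) * L.oA K t τ v * Real.exp (t * Wt v) ∂(L.μ K t τ))
    (Q := fun K t τ => ∫ v, (∏ X ∈ L.fac K t τ,
      Real.exp (EB (fun i => g (K + 1) (i + 1)) (uB K v) X - EB (fun i => g (K + 1) (i + 1)) L.oneB X)) *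
        L.oB K t τ v * Real.exp (t * Wt v) ∂(L.μ K t τ))
    (fun _ _ _ => rfl) (fun _ _ _ => rfl)
  exact ⟨δ, core_congr_on_good (fun K t ht τ hτ => ⟨hP K t ht τ hτ, hQ K t ht τ hτ⟩) hc, hs⟩

/-- **VACUUM READING** (the intended instance, side by side with `N19VacuumMGFRoad.coreEdge_of_vacuumLedgerAtSync_mgfForm`): the ledger
of record ON THE VACUUM CORES `(K, t, τ) ↦ P K 0 τ`, `Q K 0 τ` (every `t`-slot of the data idle EXCEPT that `L.μ K t τ` may be taken
`t`-constant), the in-edges BY NAME, ONE measurable bounded observable `Wt` of the integration variable, and the DRESSED FORMAT of the cores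
of record on the good classes ⇒ the DRESSED `Core` with a summable `δ`.  Road (ii)'s four extra binders (`MGFForm` ×2, `TiltedMeanMatching η`,
`Summable η`) and `0 < vol` are ABSENT; the remainder is the vacuum ledger's own `δ` (road (ii): `δ⁰ + (l₀∕vol)·η`). Lens v8 sketch, lifted. [folklore] -/
theorem coreEdge_dress_of_vacuumLedgerAtSync
    (hL : LedgerAtSync L l₀ vol T Bad (fun K _ τ => P K 0 τ) (fun K _ τ => Q K 0 τ) R EA EB κ g uA uB ω θc θ₅ θ₃)
    (h16 : NE3Shape R C₃ θ₃) (hC₃ : 0 ≤ C₃) (hgd : GaugeDominated R uA uB)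
    (h18 : NE5 EA EB W κ θ₅ C₅) (hθ₅ : 0 ≤ θ₅) (hC₅ : 0 ≤ C₅)
    (h22 : NE9 EA W κ Λm ∧ T4OutputRate.FadingMemory C₉ ω Λm) (hω : 0 ≤ ω)
    (hinj : InjectedRate Cd 0 θc (fun K j => T4CouplingMatching.disc (g K) (g (K + 1)) j)) (hCd : 0 ≤ Cd)
    (hθc : 0 ≤ θc) (hbox : ∀ K i, i ≤ K → 0 < g K i ∧ g K i ≤ γ)
    (hU : LipBackground EA W κ CU) (hG : PolyLipGrowth CU g Pg q) (hPg : 0 ≤ Pg)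
    (hgA : ∀ K, g K ∈ W) (hgB : ∀ K, (fun i => g (K + 1) (i + 1)) ∈ W)
    (hWm : Measurable Wt) (hWb : ∀ v, |Wt v| ≤ Bw)
    (hP : ∀ K t, |t| ≤ l₀ → ∀ τ ∈ T K \ Bad K t, P K t τ = ∫ v, (∏ X ∈ L.fac K t τ,
      Real.exp (EA (g K) (uA K v) X - EA (g K) L.oneA X)) * L.oA K t τ v * Real.exp (t * Wt v) ∂(L.μ K t τ))
    (hQ : ∀ K t, |t| ≤ l₀ → ∀ τ ∈ T K \ Bad K t, Q K t τ = ∫ v, (∏ X ∈ L.fac K t τ,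
      Real.exp (EB (fun i => g (K + 1) (i + 1)) (uB K v) X - EB (fun i => g (K + 1) (i + 1)) L.oneB X)) *
        L.oB K t τ v * Real.exp (t * Wt v) ∂(L.μ K t τ)) :
    ∃ δ : ℕ → ℝ, NE7.Core l₀ vol T Bad P Q δ ∧ Summable δ :=
  coreEdge_of_ledgerAtSync_dressedOnGood hL h16 hC₃ hgd h18 hθ₅ hC₅ h22 hω hinj hCd hθc hbox hU hG hPg hgA hgB hWm hWb hP hQ

end Edge

/-! ## §4 The single-run junction: an MGF form + a REPRESENTATION identity on the unit-lattice configuration space ⇒ the dressed format -/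

section Junction

variable {ι : Type} [MeasurableSpace ι] {Ω Y : Type*} [MeasurableSpace Ω] [MeasurableSpace Y]

/-- **REPRESENTATION ⇒ DRESSED FORMAT** (one run, one class).  If the class measure `ν` on the run's own field space `Ω`, pushed to the
unit-lattice configuration space `Y` by the run's key map `a` (the block averaging `A_k` of `UnitFactorisation.fac : obs k o = W o ∘ A k`),
EQUALS the ledger's density `f ≥ 0` against its reference measure `μ` on the readings `ι`, pushed to `Y` by the readings' field map `fld`
— the object-bound identity «RG images are densities», [Balaban1987RG1] (0.13) p.254 ∕ [Balaban1988Convergent] (2.24)–(2.25), cell NODE O —, then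
the MGF of the observable `φ ∘ a` under `ν` IS the dressed ledger integral `∫ f·e^{t·(φ ∘ fld)} dμ` for EVERY `t`.  Pure transport
(`integral_map` twice). Lens v8 sketch, lifted. [folklore] -/
theorem mgf_eq_dressedIntegral_of_rep {ν : Measure Ω} {a : Ω → Y} (ha : Measurable a) {μ : Measure ι} {f : ι → ℝ}
    (hfm : Measurable f) (hf0 : ∀ v, 0 ≤ f v) {fld : ι → Y} (hfld : Measurable fld) {φ : Y → ℝ} (hφ : Measurable φ)
    (hrep : ν.map a = (μ.withDensity fun v => ENNReal.ofReal (f v)).map fld) (t : ℝ) :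
    ∫ ω, Real.exp (t * φ (a ω)) ∂ν = ∫ v, f v * Real.exp (t * φ (fld v)) ∂μ := by
  have hint : Measurable fun y => Real.exp (t * φ y) := (measurable_const.mul hφ).exp
  have h1 : ∫ ω, Real.exp (t * φ (a ω)) ∂ν = ∫ y, Real.exp (t * φ y) ∂(ν.map a) :=
    (integral_map ha.aemeasurable hint.aestronglyMeasurable).symm
  rw [h1, hrep, integral_map hfld.aemeasurable hint.aestronglyMeasurable,
    T4VarianceMatching.integral_withDensity_ofReal_mul hfm hf0]

/-- The same with the product written `density · weight` ↦ `integrand · e^{tW}` in the order of §2–§3's format hypotheses. Lens v8 sketch, lifted. [folklore] -/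
theorem dressedFormat_of_rep {ν : Measure Ω} {a : Ω → Y} (ha : Measurable a) {μ : Measure ι} {f : ι → ℝ}
    (hfm : Measurable f) (hf0 : ∀ v, 0 ≤ f v) {fld : ι → Y} (hfld : Measurable fld) {φ : Y → ℝ} (hφ : Measurable φ)
    (hrep : ν.map a = (μ.withDensity fun v => ENNReal.ofReal (f v)).map fld) {Pt : ℝ → ℝ}
    (hPt : ∀ t, Pt t = ∫ ω, Real.exp (t * φ (a ω)) ∂ν) (t : ℝ) :
    Pt t = ∫ v, f v * Real.exp (t * (φ ∘ fld) v) ∂μ := by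
  rw [hPt t, mgf_eq_dressedIntegral_of_rep ha hfm hf0 hfld hφ hrep t]
  rfl

end Junction

/-! ## §5 The `S_N19` reading at the spine carriers on this road (pin of record, as every landed N19 reading) -/

section Reading

variable {N : ℕ} [NeZero N]

/-- **`S_N19` FROM A DRESSED-LEDGER READING** [bookkeeping].  If the carriers of record and K4's inputs hand, for every bundle, a synchronised
ledger for SOME cores `A₀ B₀` (the vacuum cores of record in the intended instance) with the in-edges BY NAME exactly as
`N19AtSpineCarriers.s_N19_of_ledgerAtSyncReading`, plus ONE measurable bounded observable `Wt` of the ledger's integration variable such that the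
record's shell-free cores have the DRESSED FORMAT on the good classes — then `YMDAG.UVSplit.S_N19 SRec Inputs`.  Compared with
`s_N19_of_ledgerAtSyncReading`: the ledger is asked for `A₀ B₀` (e.g. `t`-idle), not for the dressed cores; compared with
`N19VacuumMGFRoad.s_N19_of_vacuumCoreMGFReading`: no `MGFForm`, no `TiltedMeanMatching`, no `0 < S.vol`. NOT NE7. Lens v8 sketch, lifted. [folklore] -/
theorem s_N19_of_dressedLedgerReading (SRec : SpineRecordPred N) (Inputs : InputsPred N)
    (hpin : ∀ (F : T4Continuum.T4Family) (D : YMDAG.UVSplit.Datum F N) (g₀ : ℕ → ℝ) (os : List (T4Continuum.ULoop F))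
      (S : SpineCarriers), SRec F D g₀ os S → letI := S.dec
      S.δ = deltaOfRecord S.l₀ S.vol S.T S.Bad (fun K t τ => S.A K t τ - S.shA K t τ) (fun K t τ => S.B K t τ - S.shB K t τ))
    (hread : ∀ (F : T4Continuum.T4Family) (D : YMDAG.UVSplit.Datum F N) (g₀ : ℕ → ℝ) (os : List (T4Continuum.ULoop F))
      (S : SpineCarriers), SRec F D g₀ os S → Inputs F D g₀ os → letI := S.dec
      ∃ (C : Carriers) (_ : DecidableEq C.Dom) (F' : Type) (ι' X' : Type) (_ : MeasurableSpace ι')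
        (L : LedgerDataSync C F' ι' S.ι) (R : Readings ι' X') (W : Set (ℕ → ℝ)) (EA : Functional C C.BgA)
        (EB : Functional C C.BgB) (κ θ₅ C₅ C₉ ω θc Cd γ C₃ θ₃ Pg : ℝ) (q : ℕ) (Λm : ℕ → ℕ → ℝ)
        (CU : (ℕ → ℝ) → ℕ → ℝ) (g : ℕ → ℕ → ℝ) (uA : ℕ → ι' → C.BgA) (uB : ℕ → ι' → C.BgB)
        (A₀ B₀ : ℕ → ℝ → S.ι → ℝ) (Wt : ι' → ℝ) (Bw : ℝ),
        LedgerAtSync L S.l₀ S.vol S.T S.Bad A₀ B₀ R EA EB κ g uA uB ω θc θ₅ θ₃ ∧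
        NE3Shape R C₃ θ₃ ∧ 0 ≤ C₃ ∧ GaugeDominated R uA uB ∧
        NE5 EA EB W κ θ₅ C₅ ∧ 0 ≤ θ₅ ∧ 0 ≤ C₅ ∧
        (NE9 EA W κ Λm ∧ T4OutputRate.FadingMemory C₉ ω Λm) ∧ 0 ≤ ω ∧
        InjectedRate Cd 0 θc (fun K j => T4CouplingMatching.disc (g K) (g (K + 1)) j) ∧ 0 ≤ Cd ∧ 0 ≤ θc ∧
        (∀ K i, i ≤ K → 0 < g K i ∧ g K i ≤ γ) ∧
        LipBackground EA W κ CU ∧ PolyLipGrowth CU g Pg q ∧ 0 ≤ Pg ∧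
        (∀ K, g K ∈ W) ∧ (∀ K, (fun i => g (K + 1) (i + 1)) ∈ W) ∧
        Measurable Wt ∧ (∀ v, |Wt v| ≤ Bw) ∧
        (∀ K t, |t| ≤ S.l₀ → ∀ τ ∈ S.T K \ S.Bad K t, S.A K t τ - S.shA K t τ = ∫ v, (∏ X ∈ L.fac K t τ,
          Real.exp (EA (g K) (uA K v) X - EA (g K) L.oneA X)) * L.oA K t τ v * Real.exp (t * Wt v) ∂(L.μ K t τ)) ∧
        (∀ K t, |t| ≤ S.l₀ → ∀ τ ∈ S.T K \ S.Bad K t, S.B K t τ - S.shB K t τ = ∫ v, (∏ X ∈ L.fac K t τ,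
          Real.exp (EB (fun i => g (K + 1) (i + 1)) (uB K v) X - EB (fun i => g (K + 1) (i + 1)) L.oneB X)) *
            L.oB K t τ v * Real.exp (t * Wt v) ∂(L.μ K t τ))) :
    S_N19 SRec Inputs := by
  refine s_N19_of_coreEdge SRec Inputs hpin fun F D g₀ os S hS hI => ?_
  letI := S.dec
  obtain ⟨C, _, F', ι', X', _, L, R, W, EA, EB, κ, θ₅, C₅, C₉, ω, θc, Cd, γ, C₃, θ₃, Pg, q, Λm, CU, g, uA, uB, A₀, B₀, Wt, Bw,
    hL, h16, hC₃, hgd, h18, hθ₅, hC₅, h22, hω, hinj, hCd, hθc, hbox, hU, hG, hPg, hgA, hgB, hWm, hWb, hP, hQ⟩ :=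
    hread F D g₀ os S hS hI
  exact coreEdge_of_ledgerAtSync_dressedOnGood hL h16 hC₃ hgd h18 hθ₅ hC₅ h22 hω hinj hCd hθc hbox hU hG hPg hgA hgB hWm hWb
    hP hQ

end Reading

end Summit.QuantumFields.YangMills.BalabanUVNodes.N19LedgerDress

end
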